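import Summits.AnomalousDissipation.AnomalousDissipation.Theses.BaireTransfer
import Summits.AnomalousDissipation.AnomalousDissipation.Theorems.DenseLoudDesignerForces.Negative.Scaling
import Literature.Analysis.FluidPDE.StatisticalSolution
import Literature.Analysis.FluidPDE.LongTimeAveragePeriodic
import HarnessLib.Audit

/-!
# Line `ergodic-budget-selection-closing` — skeleton for crux `BaireTransfer.DenseLoudDesignerForces`
(item stmt-AnomalousDissipation-1143, route route-AnomalousDissipation-BaireTransfer)

Crux (fixed; `Negative.denseLoudDesignerForces_iff` is `Iff.rfl`): `∀ S₀ ∃ S ⊇ S₀ ∃ E ε > 0 ∃ U ⊆ P_S` open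
non-empty `∀ j, U ⊆ closure LOUD_j(S,E,ε)`, where `c ∈ LOUD_j` iff the steady trigonometric-polynomial force
`f_c = force S c` carries, at SOME `ν ∈ (0, 1/(j+1))`, a `τ`-periodic classical NS solution with
`meanEnergy ≤ E` and `meanDissipation ≥ ε`.

Idea (crux idea card `Ideas/ergodic-budget-selection-closing.md`, ideator 5, round 2; triage r2-1/2/3: pass ×3,
engine-merged with `homoclinic-excursion-trains`).  The crux's recorded why-might-fail calls the clause "EXACT
periodic orbits at tiny ν" tool-less (UPO lore).  The lever discharges exactly that clause at FIXED `ν > 0`, where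
NS on `T³` restricted to a compact invariant set of strong solutions is a smooth compact dynamical system:
(1) BUDGET SELECTION (`budget_selection`, PROVED below, verbatim from `SketchIdeator5.lean`): a loud INVARIANT
probability measure (ensemble energy `≤ E`, ensemble dissipation `≥ ε`) has, by the trajectory-wise power budget
`D ≤ ‖f_c‖₂ √En` and Markov, a positive-measure set of trajectories whose OWN time-averaged budgets are loud with
a `j`-UNIFORM inflation `(16F²E²/ε², ε/2)`; (2) CLOSING: if the measure is hyperbolic (the chaotic hypothesis (H)
on one loud component: no zero Lyapunov exponent of the linearised NS cocycle except the flow direction), Katok's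
closing lemma in Lian–Young's Hilbert-space/semiflow form closes a typical recurrence of such a trajectory into a
periodic orbit of the SAME force shadowing it, hence with period-mean budgets within any `δ` — a loud classical
`T`-periodic witness: `c ∈ LOUD_j(16F²E²/ε² + ε/4, ε/4)`.  Density of `LOUD_j` in a window is thereby reduced to
density of forces carrying ONE loud hyperbolic invariant measure at some `ν < 1/(j+1)` (the Transfer `C⁺_H` of
the card = `stub_denseHyperbolicLoudMeasures`, the honest residual: milestone `DenseLoudLerayHopfForces`
(stmt-1149) in measure form + the chaotic hypothesis).  The phase space is the MEAN-ZERO energy space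
`H = Torus.energySpace (Fin 3)` (Constantin–Foias' `H`; `f_c` is mean-free, `lerayCoeff 0 = 0`, so the mean is
conserved) — this is the card's conserved-mean slice `H_V` at `V = 0`, in which hyperbolicity is satisfiable
(the three Galilean neutral directions live outside it; crux 1144 triage X2).

## Architecture: interface (hypothesis structures) + one construction statement + three dischargeable stubs

Vocabulary (defs, this file): `Hsp` (= `H`), `rep`, `enstrophyObs`, `energyAvg`, `dissipAvg` (trajectory time
means), `IsNSPhase ν F K φ` (a compact set `K ⊂ H` of smooth states carrying global classical NS_ν(F) solutions
that stay in it, with its semiflow `φ` — an INTERFACE of hypotheses, no existence smuggled), `IsInvariantMeasure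
K φ μ`, `IsLinearizedNSSolutionOn`, `SubExpGrowth`, `ExpDecay`, `IsHyperbolicMeasure` (classical form of "no zero
exponent but the flow direction", stated through smooth solutions of the linearised equation — no Oseledets
theory needed to STATE it), `HasKatokClosing` (output shape of the closing lemma), `hypLoudSet`.

Stubs (5):
* `stub_denseHyperbolicLoudMeasures` — the Transfer `C⁺_H` (CONSTRUCTION statement; the residual; hardest).
* `stub_closingLemma` — (H) ⇒ Katok closing along Pesin sets, for the NS_ν semiflow on `K` (LianYoung2012;
  BarreiraPesin2023 Thm 11.10; XL to formalise, printed theorem).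
* `stub_birkhoffPowerBudget` — Birkhoff limits of the energy/dissipation time means exist a.e., integrate to the
  ensemble budgets, and obey the power budget `D ≤ ‖F‖₂√En` pointwise (tree: Birkhoff theorem PROVED in
  `Literature/Dynamics/Ergodic/BirkhoffErgodicTheoremProofs`, energy equality of classical solutions).
* `stub_closingWithBudgets` — Poincaré recurrence inside a positive-measure budget cell ∩ Pesin set + closing +
  uniform continuity of the observables on compact `K` ⇒ a periodic point of the semiflow with time-mean budgets
  within `δ` (pure ergodic theory / topology).
* `stub_classicalPeriodicWitness` — a periodic point of the semiflow on `K` IS a classical time-periodic NS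
  solution on `ℝ × T³` of the same force, with `meanEnergy`/`meanDissipation` equal to the trajectory means.

Glue (sorry-free): `budget_selection` (the card's first lemma), `sqrt_forceEnergy_le` (force size on a ball),
`loudAt_of_hypLoud` (the chain (1)–(2) at one force), `subset_closure_inter_of_isOpen`, and the composition
`DenseLoudDesignerForces_of : DenseLoudDesignerForces` (shrink the window to a ball so that `F = ‖f_c‖₂` is
bounded, inflate the budgets ONCE, `j`-uniformly, and push density through `closure_mono`).

WHERE THE CRUX'S ONE RELAXATION ENTERS (triage r2-3 sharpen): only in `stub_denseHyperbolicLoudMeasures` — the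
force carrying the loud hyperbolic measure may be re-chosen per level `j` (density in `U`, never membership of a
fixed `c`); every other stub works at ONE `(c, ν)`.

## Disproof.lean obligations honoured (cdisprove gen 2–3; `Theorems/DenseLoudDesignerForces/Negative/*` imported)

* §7 `denseLoudDesignerForces_false_without_convection` (H := the convective term is load-bearing): the line USES
  it — `IsNSPhase.trajectory` demands genuine NS trajectories and `stub_denseHyperbolicLoudMeasures` asks them to be
  LOUD; by §7/§8 (`reynoldsWork_ge`) the closed orbit inherits the Reynolds-work floor of the shadowed trajectory.
  Nothing Stokes-like can satisfy `hypLoudSet` at small `ν` (Stokes orbits of bounded energy are quiet, §7).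
* §3 `meanDissipation_sq_le` (power budget) is the MODEL of `stub_birkhoffPowerBudget`'s pointwise `D ≤ ‖F‖₂√En`
  (same energy-equality argument along a trajectory instead of a period) and the hypothesis `hpow` of
  `budget_selection`; §4/§6 (`integral_norm_sq_force_le`, `coeffNormSq_le_card_mul`) give the `j`-uniform `F` on
  the shrunken window (`sqrt_forceEnergy_le`).
* §9 BandLimited / §13 Beltrami refuted strengthenings: untouched — `K` is any compact invariant set of smooth
  states, never a Galerkin/Beltrami family; closed orbits shadow loud trajectories and inherit their spectral reach.
* §10 scaling (`loudAt_iff_timeRescale`): every notion here is covariant (exponents scale, hyperbolicity and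
  closing are scale-free); no level transport is attempted (each level closes at its own `ν`).
* §12 `denseLoudDesignerForces_false_planar`: `stub_denseHyperbolicLoudMeasures` is a genuinely 3-D hypothesis (in
  the planar class loud bounded invariant measures do not exist by the same Alexakis–Doering chain) — consistent.
* §17 period floor: closing orbits have LONG periods (`T ≈ n`, a recurrence time) — compatible.
* Refuted strengthenings AtRest/Everywhere/SameStock (§4), FreeBudgets/ConeWindow: not touched (the composition
  keeps the crux's quantifier prefix and shrinks `U` to a ball around a point of the given window).
* Landed `Negative/*` lemmas: imported via `Negative.Scaling`; no stub is an instance of a refuted statement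
  (none of them concerns invariant measures, closing, or hyperbolicity).
-/

set_option linter.dupNamespace false
set_option linter.unusedSectionVars false

noncomputable section

open scoped BigOperators Topology ENNReal InnerProductSpace
open Filter Set Function MeasureTheory

namespace Summit.AnomalousDissipation.AnomalousDissipation.Cruxes.DenseLoudDesignerForces.ErgodicBudgetSelectionClosing

open Literature.Analysis.FunctionSpaces Literature.Analysis.FunctionSpaces.Torus
open Literature.Analysis.FluidPDE Literature.Analysis.FluidPDE.Torus
open Summit.AnomalousDissipation.AnomalousDissipation.Theses.BaireTransfer
open Summit.AnomalousDissipation.AnomalousDissipation.Theorems.DenseLoudDesignerForces.Negative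

/-- The flat unit torus `T³`. -/
local notation "𝕋³" => UnitAddTorus (Fin 3)
/-- Real velocity values. -/
local notation "ℝ³" => EuclideanSpace ℝ (Fin 3)
/-- Complex Fourier coefficient values. -/
local notation "ℂ³" => EuclideanSpace ℂ (Fin 3)

/-! ## §0 Phase space, observables, trajectory means -/

/-- The PHASE SPACE of the line: Constantin–Foias' energy space `H = L²_σ(T³)` of square-integrable, weakly
divergence-free, MEAN-ZERO vector fields (the tree's `Torus.energySpace`, a closed subspace of `L²(T³; ℝ³)`, Borel
σ-algebra `Torus.instMeasurableSpaceEnergySpace`).  Mean zero is the card's conserved-mean slice at `V = 0`.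
[cite: ConstantinFoiasNSE1988, Ch. 4 (the space H)] -/
abbrev Hsp : Type := ↥(energySpace (Fin 3))

/-- A representative `T³ → ℝ³` of a state `v ∈ H` (the `L²` class coerced to a function; integrals and Fourier
coefficients do not depend on the representative). [folklore] -/
@[folklore] def rep (v : Hsp) : 𝕋³ → ℝ³ :=
  ((v : Lp ℝ³ 2 (volume : Measure 𝕋³)) : 𝕋³ → ℝ³)

/-- The enstrophy observable `‖∇v‖₂²` of a state (spectral `Torus.eGradNormSq`, converted to `ℝ`; junk `0` at
states of infinite enstrophy, which `IsNSPhase.enstrophy_finite` excludes on `K`). [cite: DoeringFoias2002, §2] -/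
@[folklore] def enstrophyObs (v : Hsp) : ℝ :=
  (eGradNormSq (rep v)).toReal

/-- Time-mean energy `T⁻¹ ∫₀ᵀ ‖φ_t x‖₂² dt` of the trajectory of `x` under the semiflow `φ`. [cite: DoeringFoias2002, §2] -/
@[folklore] def energyAvg (φ : ℝ → Hsp → Hsp) (x : Hsp) (T : ℝ) : ℝ :=
  T⁻¹ * ∫ t in (0 : ℝ)..T, ‖φ t x‖ ^ 2

/-- Time-mean dissipation `T⁻¹ ∫₀ᵀ ν‖∇φ_t x‖₂² dt` of the trajectory of `x`. [cite: DoeringFoias2002, §2] -/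
@[folklore] def dissipAvg (ν : ℝ) (φ : ℝ → Hsp → Hsp) (x : Hsp) (T : ℝ) : ℝ :=
  T⁻¹ * ∫ t in (0 : ℝ)..T, ν * enstrophyObs (φ t x)

/-! ## §1 The interface: a compact invariant set of strong solutions with its semiflow, invariant measures -/

/-- **NS phase (interface of hypotheses; existence is asserted only by `stub_denseHyperbolicLoudMeasures`).**
`K ⊂ H` is a compact set of states and `φ : ℝ → H → H` (junk outside `Ici 0 × K`) a semiflow on it such that:
`φ_t` maps `K` into itself (`t ≥ 0`), `φ_0 = id` and `φ_{s+t} = φ_s ∘ φ_t` on `K`, `(t,x) ↦ φ_t x` is jointly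
continuous on `Ici 0 × K`, the enstrophy is finite and `L²`-continuous on `K` (true on `H²`-bounded sets by
interpolation — parabolic smoothing makes compact invariant sets of strong solutions bounded in every `H^s`), and
every trajectory is a GLOBAL CLASSICAL solution of NS_ν forced by the steady `F`: for `x ∈ K` there are `u, p`
jointly smooth on `[0,∞) × T³` solving the system with `u(t)` representing `φ_t x`.  At fixed `ν > 0` this is the
standard dynamical-systems frame of 3-D NS on a compact invariant set of strong solutions (FMRT 2001 Ch. III–IV;
ConstantinFoias 1988). [cite: FMRTTurbulence2001, Ch. IV §2 (invariant measures and stationary statistical solutions)] -/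
@[folklore] structure IsNSPhase (ν : ℝ) (F : 𝕋³ → ℝ³) (K : Set Hsp) (φ : ℝ → Hsp → Hsp) : Prop where
  /-- `K` is compact in `H`. -/
  isCompact : IsCompact K
  /-- Forward invariance. -/
  mapsTo : ∀ t : ℝ, 0 ≤ t → MapsTo (φ t) K K
  /-- `φ_0 = id` on `K`. -/
  map_zero : ∀ x ∈ K, φ 0 x = x
  /-- Semigroup law on `K`. -/
  map_add : ∀ s t : ℝ, 0 ≤ s → 0 ≤ t → ∀ x ∈ K, φ (s + t) x = φ s (φ t x)
  /-- Joint continuity on `Ici 0 × K`. -/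
  continuousOn : ContinuousOn (fun q : ℝ × Hsp => φ q.1 q.2) (Ici 0 ×ˢ K)
  /-- Finite enstrophy on `K`. -/
  enstrophy_finite : ∀ x ∈ K, eGradNormSq (rep x) ≠ ∞
  /-- The enstrophy is `L²`-continuous on `K`. -/
  enstrophy_continuousOn : ContinuousOn enstrophyObs K
  /-- Trajectories are global classical NS solutions forced by `F`. -/
  trajectory : ∀ x ∈ K, ∃ (u : ℝ → 𝕋³ → ℝ³) (p : ℝ → 𝕋³ → ℝ),
    IsClassicalNSSolutionOn (Ici 0) ν (fun _ => F) u p ∧ ∀ t : ℝ, 0 ≤ t → rep (φ t x) =ᵐ[volume] u t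

/-- **Invariant probability measure carried by `K`**: `μ` is a Borel probability measure on `H` with `μ(Kᶜ) = 0`
and `(φ_t)_* μ = μ` for `t ≥ 0` (as `Measure.map`; a non-a.e.-measurable `φ_t` would give `map = 0 ≠ μ`, so the
identity also records a.e.-measurability).  Ergodicity is NOT assumed anywhere in the line. [cite: FMRTTurbulence2001, Ch. IV §2 Def. 2.1] -/
@[folklore] structure IsInvariantMeasure (K : Set Hsp) (φ : ℝ → Hsp → Hsp) (μ : Measure Hsp) : Prop where
  /-- Probability measure. -/
  prob : IsProbabilityMeasure μ
  /-- Carried by `K`. -/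
  null_compl : μ Kᶜ = 0
  /-- Invariance under the semiflow. -/
  map_eq : ∀ t : ℝ, 0 ≤ t → Measure.map (φ t) μ = μ

/-! ## §2 Hyperbolicity (classical form) and the closing property -/

/-- **The linearised Navier–Stokes equation along the space–time field `u`** on the time set `S`:
`w, q` jointly smooth on `S × T³`, `w(t)` divergence free and mean zero (in-slice linearisation: the mean is
conserved because the force is mean-free), and `∂ₜw + (u·∇)w + (w·∇)u = νΔw − ∇q` pointwise.  This is the
derivative cocycle of the NS_ν semiflow written classically (Henry 1981 Ch. 8; the same predicate, with an
inhomogeneity, is `LinNSAround` of the sibling line `RobustLoudUpgrade/Lines/drift-wave-symmetry-upgrade`).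
[cite: Henry1981, Ch. 8] -/
@[folklore] def IsLinearizedNSSolutionOn (S : Set ℝ) (ν : ℝ) (u w : ℝ → 𝕋³ → ℝ³) (q : ℝ → 𝕋³ → ℝ) : Prop :=
  IsSmoothSpaceTimeOn S w ∧ IsSmoothSpaceTimeOn S q ∧ (∀ t ∈ S, IsDivFree (w t)) ∧
    (∀ t ∈ S, HasZeroMean (w t)) ∧
    ∀ t ∈ S, ∀ x, Torus.timeDerivWithin S w t x + convect (u t) (w t) x + convect (w t) (u t) x =
      ν • laplacian (w t) x - Torus.gradient (q t) x

/-- Sub-exponential growth of `t ↦ ‖w(t)‖₂` along integer times: Lyapunov exponent `≤ 0` (stated without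
logarithms, so the zero solution qualifies with no junk). [cite: BarreiraPesin2023, Ch. 2 (Lyapunov exponents)] -/
@[folklore] def SubExpGrowth (w : ℝ → 𝕋³ → ℝ³) : Prop :=
  ∀ κ : ℝ, 0 < κ → ∃ C : ℝ, ∀ n : ℕ, ∫ y, ‖w n y‖ ^ 2 ≤ C * Real.exp (κ * n)

/-- Exponential decay of `t ↦ ‖w(t)‖₂` along integer times: Lyapunov exponent `< 0`. [cite: BarreiraPesin2023, Ch. 2 (Lyapunov exponents)] -/
@[folklore] def ExpDecay (w : ℝ → 𝕋³ → ℝ³) : Prop :=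
  ∃ κ : ℝ, 0 < κ ∧ ∃ C : ℝ, ∀ n : ℕ, ∫ y, ‖w n y‖ ^ 2 ≤ C * Real.exp (-(κ * n))

/-- **Hyperbolicity of an invariant measure of the NS_ν(F) semiflow — the chaotic hypothesis (H) in its weakest
usable form, stated classically.**  For `μ`-a.e. `x`, along the classical trajectory `u` of `x`: every solution
`w` of the linearised equation with sub-exponential growth becomes, after subtracting a suitable multiple of the
FLOW DIRECTION `∂ₜu(0)` from its initial value, exponentially decaying.  At Lyapunov-regular points this says
exactly: the non-positive part of the Oseledets filtration is `ℝ∂ₜu ⊕ (stable)`, i.e. NO ZERO EXPONENT EXCEPT THE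
SIMPLE ONE OF THE FLOW DIRECTION (Lian–Young's hypothesis for semiflows; the cocycle is injective and compact by
backward uniqueness and parabolic smoothing, facts the prover of `stub_closingLemma` supplies).  Positive entropy
is not required for closing.  Equilibria (where `∂ₜu = 0`) must then be hyperbolic fixed points. [cite: LianYoung2012, §1 (standing hypotheses: exactly one zero exponent)] -/
@[folklore] def IsHyperbolicMeasure (ν : ℝ) (F : 𝕋³ → ℝ³) (φ : ℝ → Hsp → Hsp) (μ : Measure Hsp) : Prop :=
  ∀ᵐ x ∂μ, ∀ (u : ℝ → 𝕋³ → ℝ³) (p : ℝ → 𝕋³ → ℝ), IsClassicalNSSolutionOn (Ici 0) ν (fun _ => F) u p →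
    (∀ t : ℝ, 0 ≤ t → rep (φ t x) =ᵐ[volume] u t) →
    ∀ (w : ℝ → 𝕋³ → ℝ³) (q : ℝ → 𝕋³ → ℝ), IsLinearizedNSSolutionOn (Ici 0) ν u w q → SubExpGrowth w →
      ∃ a : ℝ, ∀ (w' : ℝ → 𝕋³ → ℝ³) (q' : ℝ → 𝕋³ → ℝ), IsLinearizedNSSolutionOn (Ici 0) ν u w' q' →
        w' 0 = w 0 - a • Torus.timeDerivWithin (Ici 0) u 0 → ExpDecay w'

/-- **Katok closing along Pesin sets (the OUTPUT SHAPE of the closing lemma for the semiflow `φ` on `K`).**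
There are measurable sets `Λ_ℓ ⊆ K` exhausting `μ`-almost all of `H` such that for every `ℓ` and `η > 0` there is
`δ > 0` with: whenever `x ∈ Λ_ℓ` returns at an integer time `n ≥ 1` to `Λ_ℓ` within distance `δ` of itself, some
`z ∈ K` is periodic under the semiflow with a period `T`, `|T − n| ≤ η`, and its orbit `η`-shadows that of `x` at
the integer times `0 ≤ k ≤ n` (Katok 1980 Main Lemma; Barreira–Pesin 2023 Thm 11.10 and [13, §15.1]; for
semiflows on Hilbert spaces with one zero exponent: Lian–Young 2012). [cite: BarreiraPesin2023, Thm 11.10] -/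
@[folklore] def HasKatokClosing (K : Set Hsp) (φ : ℝ → Hsp → Hsp) (μ : Measure Hsp) : Prop :=
  ∃ Λ : ℕ → Set Hsp, (∀ ℓ, MeasurableSet (Λ ℓ)) ∧ (∀ ℓ, Λ ℓ ⊆ K) ∧ μ (⋃ ℓ, Λ ℓ)ᶜ = 0 ∧
    ∀ ℓ : ℕ, ∀ η : ℝ, 0 < η → ∃ δ : ℝ, 0 < δ ∧
      ∀ x ∈ Λ ℓ, ∀ n : ℕ, 0 < n → φ n x ∈ Λ ℓ → dist (φ n x) x < δ →
        ∃ z ∈ K, ∃ T : ℝ, 0 < T ∧ |T - n| ≤ η ∧ φ T z = z ∧ ∀ k : ℕ, k ≤ n → dist (φ k z) (φ k x) ≤ η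

/-- **The set `HYP_j(S,E,ε)` of forces carrying a loud hyperbolic invariant measure at level `j`**: at SOME
`ν ∈ (0, 1/(j+1))` the steady force `f_c` admits an NS phase `(K, φ)` with an invariant probability measure `μ` on
`K` of ensemble energy `≤ E` (`Torus.ensembleEnergy`), ensemble dissipation `≥ ε` (`Torus.ensembleDissipation`;
its junk value `0` at infinite mean enstrophy only makes the condition fail) which is hyperbolic.  An ergodic loud
hyperbolic measure (the card's `C⁺_H`) is the basic instance; ergodicity is not needed. [cite: FMRTTurbulence2001, Ch. V §1 (ensemble averages)] -/
@[folklore] def hypLoudSet (S : Finset (Fin 3 → ℤ)) (E ε : ℝ) (j : ℕ) : Set (↥S → ℂ³) :=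
  {c | ∃ ν : ℝ, 0 < ν ∧ ν < 1 / ((j : ℝ) + 1) ∧
    ∃ (K : Set Hsp) (φ : ℝ → Hsp → Hsp) (μ : Measure Hsp),
      IsNSPhase ν (force S c) K φ ∧ IsInvariantMeasure K φ μ ∧
        ensembleEnergy μ ≤ E ∧ ε ≤ ensembleDissipation ν μ ∧ IsHyperbolicMeasure ν (force S c) φ μ}

/-! ## §3 The five stubs -/

/-- **Stub 1 — the Transfer `C⁺_H` (CONSTRUCTION statement; the residual of the whole line; HARDEST).**
For every finite stock `S₀` there are `S ⊇ S₀`, budgets `E`, `ε > 0` and an open non-empty `U ⊆ P_S` such that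
at every level `j` the forces `c ∈ P_S` carrying a LOUD HYPERBOLIC INVARIANT MEASURE of NS_ν(f_c) at some
`ν < 1/(j+1)` (`hypLoudSet`) are dense in `U`.  Content = milestone `DenseLoudLerayHopfForces` (stmt-1149) in
measure form at fixed-`ν` regularity (a loud `H¹`-bounded strong trajectory gives a loud invariant measure on a
compact invariant set by Krylov–Bogolyubov / time averages, FMRT Ch. IV) + the chaotic hypothesis (H) for (a loud
part of) it; the force may be RE-CHOSEN PER LEVEL — the crux's one relaxation is used here and only here.
Why it might fail: non-hyperbolicity is persistent in dissipative families (Newhouse tangencies, slow neutral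
large-scale modes) and no genericity theorem for (H) in the force exists; the zeroth-law half (loud bounded
dynamics for fixed-degree steady forcing as `ν → 0`) is open.  Cheapest falsifier: a robust SECOND near-zero
Lyapunov exponent in forced-box DNS under a generic two-shell steady force (card; kit test not run).
Size XL / open.  Leans on: `IsNSPhase`, `IsInvariantMeasure`, `IsHyperbolicMeasure`, `Torus.ensembleEnergy`,
`Torus.ensembleDissipation`; GallavottiCohen 1995 (chaotic hypothesis), KanedaEtAl2003 (plateau),
VanVeenKidaKawahara2006 / VanVeenVelaMartinKawahara2019 (UPOs carrying turbulent budgets).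
[cite: LianYoung2012, §1 (hyperbolic measures of dissipative parabolic semiflows)] -/
theorem stub_denseHyperbolicLoudMeasures :
    ∀ S₀ : Finset (Fin 3 → ℤ), ∃ S : Finset (Fin 3 → ℤ), S₀ ⊆ S ∧ ∃ (E ε : ℝ), 0 < ε ∧
      ∃ U : Set (↥S → ℂ³), IsOpen U ∧ U.Nonempty ∧ ∀ j : ℕ, U ⊆ closure (hypLoudSet S E ε j) := by
  sorry

/-- **Stub 2 — the closing lemma for the NS_ν semiflow (Katok; Lian–Young in Hilbert space).**
A hyperbolic invariant probability measure on an NS phase `(K, φ)` has the Katok closing property along Pesin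
sets.  Why plausible: at fixed `ν > 0` the time-1 map of NS_ν(f_c) is real-analytic on an `H²_σ`-neighbourhood
of the compact invariant set `K` (local well-posedness + compactness of `K`; a cut-off outside a neighbourhood
makes it globally defined), injective (backward uniqueness of strong solutions, ConstantinFoias 1988) with
injective COMPACT derivative (parabolic smoothing) — the standing hypotheses of Lian–Young's nonuniform
hyperbolic theory for maps/semiflows of Hilbert spaces; Pesin sets, Lyapunov charts and the closing of typical
recurrences with period drift `|T − n| ≤ η` (one zero exponent = flow direction) follow as in Katok 1980;
shadowing in chart metrics dominates the ambient `L²` metric up to a uniform constant, so the ambient orbit is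
`η`-shadowed at all integer times.  Why it might fail (as a formalisation): XL — Oseledets/Pesin theory in
Hilbert space is not in the tree; page verification of LianYoung2012's closing statement owed (acq-01690,
acq-05212).  Leans on: `IsHyperbolicMeasure`, `HasKatokClosing`; Mathlib `Dynamics`, tree
`Literature/Dynamics/Ergodic/*`. [cite: LianYoung2012, Theorem (closing lemma / periodic orbits for hyperbolic measures of semiflows)] -/
theorem stub_closingLemma {S : Finset (Fin 3 → ℤ)} {c : ↥S → ℂ³} {ν : ℝ} {K : Set Hsp} {φ : ℝ → Hsp → Hsp}
    {μ : Measure Hsp} (hν : 0 < ν) (hK : IsNSPhase ν (force S c) K φ) (hμ : IsInvariantMeasure K φ μ)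
    (hH : IsHyperbolicMeasure ν (force S c) φ μ) : HasKatokClosing K φ μ := by
  sorry

/-- **Stub 3 — Birkhoff limits of the budgets and the trajectory-wise power budget.**
For an invariant probability measure on an NS phase there are measurable integrable functions
`En ≥ 0`, `D : H → ℝ` with `∫ En dμ = e(μ)` (`Torus.ensembleEnergy`), `∫ D dμ = ε(μ)` (`Torus.ensembleDissipation`),
the POWER BUDGET `D ≤ ‖F‖₂ √En` EVERYWHERE, and such that for `μ`-a.e. `x` the time means of energy and
dissipation along the trajectory of `x` converge to `En x`, `D x`.  Why plausible / proof plan: Birkhoff's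
pointwise ergodic theorem (PROVED in tree: `ae_tendsto_birkhoffAverage_condExp`) for the `μ`-preserving time-1
map `φ 1` applied to the bounded observables `x ↦ ∫₀¹‖φ_s x‖²`, `x ↦ ∫₀¹ ν‖∇φ_s x‖²` (continuous on `K` by joint
continuity and `enstrophy_continuousOn`); continuous-time means are sandwiched by the discrete ones; space means
by Fubini + invariance (`∫∫₀¹‖φ_s x‖² = ∫‖x‖²`; the lintegral in `ensembleDissipation` is finite on compact `K`);
the pointwise bound from the energy equality of the classical trajectory (`IsClassicalNSSolutionOn.energy_eq`,
`gradNormSq_eq_toReal_eGradNormSq_holds`): `n⁻¹∫₀ⁿ ν‖∇u‖² = n⁻¹∫₀ⁿ⟨F,u⟩ − (‖u(n)‖²−‖u(0)‖²)/(2n)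
≤ ‖F‖₂ (n⁻¹∫₀ⁿ‖u‖²)^{1/2} + O(1/n)` — exactly Disproof §3 `meanDissipation_sq_le` along a trajectory — then
redefine `En, D := 0` on the null set where limits fail.  Size M–L.  Leans on: tree Birkhoff theorem,
`Torus.IsClassicalNSSolutionOn.energy_eq`, `Negative.PowerBudget`, Mathlib `MeasureTheory.integral_prod`.
[cite: FMRTTurbulence2001, Ch. IV §2–3 (time averages vs ensemble averages)] -/
theorem stub_birkhoffPowerBudget {S : Finset (Fin 3 → ℤ)} {c : ↥S → ℂ³} {ν : ℝ} {K : Set Hsp}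
    {φ : ℝ → Hsp → Hsp} {μ : Measure Hsp} (hν : 0 < ν) (hK : IsNSPhase ν (force S c) K φ)
    (hμ : IsInvariantMeasure K φ μ) :
    ∃ En D : Hsp → ℝ, Measurable En ∧ Measurable D ∧ (∀ x, 0 ≤ En x) ∧
      Integrable En μ ∧ Integrable D μ ∧ ∫ x, En x ∂μ = ensembleEnergy μ ∧
      ∫ x, D x ∂μ = ensembleDissipation ν μ ∧
      (∀ x, D x ≤ Real.sqrt (∫ y, ‖force S c y‖ ^ 2) * Real.sqrt (En x)) ∧
      ∀ᵐ x ∂μ, Tendsto (energyAvg φ x) atTop (𝓝 (En x)) ∧ Tendsto (dissipAvg ν φ x) atTop (𝓝 (D x)) := by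
  sorry

/-- **Stub 4 — closing WITH BUDGETS (recurrence in a budget cell + closing + uniform continuity on `K`).**
If `μ` is an invariant probability measure on an NS phase with the Katok closing property, `B` a measurable set
of positive measure on which the Birkhoff budgets satisfy `En ≤ E₁`, `D ≥ ε₁`, and the time means converge a.e.
to `En`, `D`, then for every `δ > 0` some `z ∈ K` is PERIODIC under the semiflow, `φ_T z = z` with `T > 0`, with
time-mean energy `≤ E₁ + δ` and dissipation `≥ ε₁ − δ` over `[0,T]`.  Proof plan: pick `ℓ` with
`μ(B ∩ Λ_ℓ) > 0`; Poincaré recurrence for the `μ`-preserving map `φ 1` (Mathlib `Conservative`, second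
countability of `H`) gives `x ∈ B ∩ Λ_ℓ` with good limits returning to `Λ_ℓ ∩ B(x, δ')` at arbitrarily large
integer times `n`; close with `η`; compare `∫₀ᵀ g(φ_t z)` with `∫₀ⁿ g(φ_t x)` for `g = ‖·‖², ν·enstrophyObs`
slab by slab `[k,k+1]` using the semigroup law and UNIFORM continuity of `(s,y) ↦ g(φ_s y)` on `[0,1] × K`
(compact), plus `|T − n| ≤ η` and boundedness of `g` on `K` for the end slab.  Size M–L; pure measure theory /
topology, all in Mathlib.  Leans on: `HasKatokClosing`, `IsNSPhase.{map_add, continuousOn,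
enstrophy_continuousOn, isCompact}`, Mathlib `MeasureTheory.Conservative.ae_mem_imp_frequently_image_mem`,
`IsCompact.uniformContinuousOn_of_continuous`. [cite: BarreiraPesin2023, Thm 11.10 (recurrence + closing at typical points)] -/
theorem stub_closingWithBudgets {ν : ℝ} {F : 𝕋³ → ℝ³} {K : Set Hsp} {φ : ℝ → Hsp → Hsp} {μ : Measure Hsp}
    {En D : Hsp → ℝ} {E₁ ε₁ : ℝ} {B : Set Hsp} (hK : IsNSPhase ν F K φ) (hμ : IsInvariantMeasure K φ μ)
    (hcl : HasKatokClosing K φ μ) (hB : MeasurableSet B) (hμB : μ B ≠ 0)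
    (hbud : ∀ x ∈ B, En x ≤ E₁ ∧ ε₁ ≤ D x)
    (hlim : ∀ᵐ x ∂μ, Tendsto (energyAvg φ x) atTop (𝓝 (En x)) ∧ Tendsto (dissipAvg ν φ x) atTop (𝓝 (D x)))
    {δ : ℝ} (hδ : 0 < δ) :
    ∃ z ∈ K, ∃ T : ℝ, 0 < T ∧ φ T z = z ∧ energyAvg φ z T ≤ E₁ + δ ∧ ε₁ - δ ≤ dissipAvg ν φ z T := by
  sorry

/-- **Stub 5 — a periodic point of the semiflow is a classical time-periodic witness of the crux.**
If `z ∈ K` satisfies `φ_T z = z` (`T > 0`), then the force `f_c` carries a classical solution `(u, p)` of NS_ν on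
ALL of `ℝ × T³`, `T`-periodic in time, whose `meanEnergy` / `meanDissipation` (the crux's limsup functionals) equal
the trajectory means over `[0,T]`.  Proof plan: the classical trajectory `u₊` of `z` on `[0,∞)`
(`IsNSPhase.trajectory`) satisfies `u₊(t+T) = u₊(t)` for `t ≥ 0` (semigroup law, continuous representatives of one
`L²` class coincide); its derivatives from the right at `0` equal those at the interior point `T`, so the
`T`-periodic extension to `ℝ` is jointly smooth and solves NS with the (mean-zero renormalised, hence periodic)
pressure; `meanEnergy_eq_of_periodic` / `meanDissipation_eq_of_periodic` turn the limsup means into period means,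
and `‖φ_t z‖² = ∫‖u(t)‖²`, `eGradNormSq (rep (φ_t z)) = eGradNormSq (u t)` (a.e.-equal representatives).
Size M.  Leans on: `Torus.IsClassicalNSSolutionOn`, `LongTimeAveragePeriodic`, `TorusClassicalNSUniqueness`,
Mathlib `MeasureTheory.Lp` norm API. [cite: Cheskidov2023, §6 (period means of time-periodic solutions)] -/
theorem stub_classicalPeriodicWitness {S : Finset (Fin 3 → ℤ)} {c : ↥S → ℂ³} {ν : ℝ} {K : Set Hsp}
    {φ : ℝ → Hsp → Hsp} {z : Hsp} {T : ℝ} (hν : 0 < ν) (hK : IsNSPhase ν (force S c) K φ) (hz : z ∈ K)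
    (hT : 0 < T) (hfix : φ T z = z) :
    ∃ (u : ℝ → 𝕋³ → ℝ³) (p : ℝ → 𝕋³ → ℝ),
      IsClassicalNSSolutionOn univ ν (fun _ => force S c) u p ∧ Function.Periodic u T ∧
        meanEnergy u = energyAvg φ z T ∧ meanDissipation ν u = dissipAvg ν φ z T := by
  sorry

/-! ## §4 Glue (sorry-free) -/

/-- **BUDGET SELECTION** (the card's first lemma; `SketchIdeator5.budget_selection` verbatim but for its unused
hypothesis `D ≥ 0`, PROVED: Markov + Cauchy–Schwarz + splitting).  Over a probability space `P` with "dissipation" `D` and "energy" `En`, the pointwise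
power budget `D ≤ F√En` and the mean budgets `∫D ≥ ε`, `∫En ≤ E` force the cell
`{En ≤ 16F²E²/ε² ∧ D ≥ ε/2}` to have probability `≥ ε²/(16F²E) > 0` — loud trajectories with a
`j`-INDEPENDENT budget inflation are free. [folklore] -/
theorem budget_selection {Ω : Type*} [MeasurableSpace Ω] (P : Measure Ω) [IsProbabilityMeasure P]
    {D En : Ω → ℝ} (hDm : Measurable D) (hEm : Measurable En) (hE0 : ∀ ω, 0 ≤ En ω)
    {F E ε : ℝ} (hF : 0 < F) (hE : 0 < E) (hε : 0 < ε)
    (hpow : ∀ ω, D ω ≤ F * Real.sqrt (En ω)) (hDi : Integrable D P) (hEi : Integrable En P)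
    (hD : ε ≤ ∫ ω, D ω ∂P) (hEn : ∫ ω, En ω ∂P ≤ E) :
    ENNReal.ofReal (ε ^ 2 / (16 * F ^ 2 * E)) ≤ P {ω | En ω ≤ 16 * F ^ 2 * E ^ 2 / ε ^ 2 ∧ ε / 2 ≤ D ω} := by
  set K : ℝ := 4 * F * E / ε with hK
  have hKpos : 0 < K := by positivity
  have hK2 : K ^ 2 = 16 * F ^ 2 * E ^ 2 / ε ^ 2 := by rw [hK]; field_simp; ring
  have hFK : F / K = ε / (4 * E) := by rw [hK]; field_simp
  set B : Set Ω := {ω | En ω ≤ 16 * F ^ 2 * E ^ 2 / ε ^ 2 ∧ ε / 2 ≤ D ω} with hB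
  have hBm : MeasurableSet B :=
    (hEm measurableSet_Iic).inter (hDm measurableSet_Ici)
  -- pointwise domination
  have hind0 : ∀ ω, 0 ≤ B.indicator (fun _ => (1:ℝ)) ω := fun ω =>
    Set.indicator_nonneg (fun _ _ => zero_le_one) ω
  have hpt : ∀ ω, D ω ≤ ε / (4 * E) * En ω + F * K * B.indicator (fun _ => (1:ℝ)) ω + ε / 2 := by
    intro ω
    have h4 : 0 ≤ ε / (4 * E) * En ω := mul_nonneg (by positivity) (hE0 ω)
    have h3 : 0 ≤ F * K * B.indicator (fun _ => (1:ℝ)) ω :=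
      mul_nonneg (mul_nonneg hF.le hKpos.le) (hind0 ω)
    by_cases hA : K ^ 2 < En ω
    · have h1 : K ≤ Real.sqrt (En ω) := by
        rw [← Real.sqrt_sq hKpos.le]; exact Real.sqrt_le_sqrt hA.le
      have hs : Real.sqrt (En ω) * K ≤ En ω := by
        calc Real.sqrt (En ω) * K ≤ Real.sqrt (En ω) * Real.sqrt (En ω) := by
              gcongr
          _ = En ω := Real.mul_self_sqrt (hE0 ω)
      have h2 : F * Real.sqrt (En ω) ≤ ε / (4 * E) * En ω := by
        calc F * Real.sqrt (En ω) = (F / K) * (Real.sqrt (En ω) * K) := by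
              field_simp
          _ ≤ (F / K) * En ω := by gcongr
          _ = ε / (4 * E) * En ω := by rw [hFK]
      linarith [hpow ω]
    · push Not at hA
      have h1 : Real.sqrt (En ω) ≤ K := by
        calc Real.sqrt (En ω) ≤ Real.sqrt (K ^ 2) := Real.sqrt_le_sqrt hA
          _ = K := Real.sqrt_sq hKpos.le
      by_cases hD2 : ε / 2 ≤ D ω
      · have hmem : ω ∈ B := ⟨by rw [← hK2]; exact hA, hD2⟩
        have hind : B.indicator (fun _ => (1:ℝ)) ω = 1 := Set.indicator_of_mem hmem _
        have h2 : F * Real.sqrt (En ω) ≤ F * K := by gcongr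
        rw [hind]; linarith [hpow ω]
      · push Not at hD2
        linarith
  -- integrate the domination
  have hIi : Integrable (fun ω => B.indicator (fun _ => (1:ℝ)) ω) P :=
    (integrable_const (1:ℝ)).indicator hBm
  have hrhs : Integrable (fun ω => ε / (4 * E) * En ω + F * K * B.indicator (fun _ => (1:ℝ)) ω + ε / 2) P :=
    ((hEi.const_mul _).add (hIi.const_mul _)).add (integrable_const _)
  have hint : ∫ ω, D ω ∂P ≤ ε / (4 * E) * (∫ ω, En ω ∂P) + F * K * (P B).toReal + ε / 2 := by
    have step := integral_mono hDi hrhs hpt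
    have h12 : Integrable (fun ω => ε / (4 * E) * En ω + F * K * B.indicator (fun _ => (1:ℝ)) ω) P :=
      (hEi.const_mul _).add (hIi.const_mul _)
    have i1 : ∫ ω, (ε / (4 * E) * En ω + F * K * B.indicator (fun _ => (1:ℝ)) ω + ε / 2) ∂P
        = (∫ ω, (ε / (4 * E) * En ω + F * K * B.indicator (fun _ => (1:ℝ)) ω) ∂P) + ∫ _ω, ε / 2 ∂P :=
      integral_add h12 (integrable_const _)
    have i2 : ∫ ω, (ε / (4 * E) * En ω + F * K * B.indicator (fun _ => (1:ℝ)) ω) ∂P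
        = (∫ ω, ε / (4 * E) * En ω ∂P) + ∫ ω, F * K * B.indicator (fun _ => (1:ℝ)) ω ∂P :=
      integral_add (hEi.const_mul _) (hIi.const_mul _)
    have i3 : ∫ ω, ε / (4 * E) * En ω ∂P = ε / (4 * E) * ∫ ω, En ω ∂P := integral_const_mul _ _
    have i4 : ∫ ω, F * K * B.indicator (fun _ => (1:ℝ)) ω ∂P = F * K * (P B).toReal := by
      rw [integral_const_mul]
      congr 1
      rw [integral_indicator hBm, setIntegral_const, smul_eq_mul, mul_one]
      rfl
    have i5 : ∫ _ω, ε / 2 ∂P = ε / 2 := by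
      rw [integral_const]; simp
    linarith [i1, i2, i3, i4, i5, step]
  have hb1 : ε / (4 * E) * (∫ ω, En ω ∂P) ≤ ε / 4 := by
    calc ε / (4 * E) * (∫ ω, En ω ∂P) ≤ ε / (4 * E) * E := by gcongr
      _ = ε / 4 := by field_simp
  have hPB : ε ^ 2 / (16 * F ^ 2 * E) ≤ (P B).toReal := by
    have hFKpos : 0 < F * K := mul_pos hF hKpos
    have h5 : ε / 4 ≤ F * K * (P B).toReal := by linarith
    have h6 : ε / 4 / (F * K) ≤ (P B).toReal := by
      rw [div_le_iff₀ hFKpos]; linarith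
    have e2 : ε / 4 / (F * K) = ε ^ 2 / (16 * F ^ 2 * E) := by rw [hK]; field_simp; ring
    linarith [e2 ▸ h6]
  exact (ENNReal.ofReal_le_iff_le_toReal (measure_ne_top P B)).2 hPB

/-- FORCE SIZE ON A BALL: for `c'` within distance `1` of `c₀`, `‖f_{c'}‖₂ ≤ √(#S) (‖c₀‖ + 1)`
(`∫‖f_c‖² ≤ ∑‖c k‖² ≤ #S ‖c‖²`, Disproof §4).  This is what makes the budget inflation `j`-UNIFORM: the window
is shrunk to a ball before the inflated budgets are chosen. [folklore] -/
theorem sqrt_forceEnergy_le {S : Finset (Fin 3 → ℤ)} {c₀ c' : ↥S → ℂ³} (h : dist c' c₀ < 1) :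
    Real.sqrt (∫ y, ‖force S c' y‖ ^ 2) ≤ Real.sqrt (S.card * (‖c₀‖ + 1) ^ 2) := by
  apply Real.sqrt_le_sqrt
  have h1 := integral_norm_sq_force_le S c'
  have h2 := coeffNormSq_le_card_mul c'
  have h3 : ‖c'‖ ≤ ‖c₀‖ + 1 := by
    have h5 := norm_sub_norm_le c' c₀
    rw [dist_eq_norm] at h
    linarith
  have h4 : (S.card : ℝ) * ‖c'‖ ^ 2 ≤ S.card * (‖c₀‖ + 1) ^ 2 := by
    apply mul_le_mul_of_nonneg_left _ (Nat.cast_nonneg _)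
    exact pow_le_pow_left₀ (norm_nonneg _) h3 2
  linarith

/-- **The chain (1)–(2) at ONE force**: a loud hyperbolic invariant measure of NS_ν(f_c) with `‖f_c‖₂ ≤ F`
yields a loud classical periodic witness of the SAME force at the SAME `ν`, with the `j`-uniformly inflated
budgets `(16F²E²/ε² + ε/4, ε/4)`: closing lemma (Stub 2) → Birkhoff budgets (Stub 3) → `budget_selection`
(proved) → closing with budgets (Stub 4, `δ := ε/4`) → classical witness (Stub 5). [folklore] -/
theorem loudAt_of_hypLoud {S : Finset (Fin 3 → ℤ)} {c : ↥S → ℂ³} {ν : ℝ} {K : Set Hsp} {φ : ℝ → Hsp → Hsp}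
    {μ : Measure Hsp} {E ε F : ℝ} (hν : 0 < ν) (hK : IsNSPhase ν (force S c) K φ)
    (hμ : IsInvariantMeasure K φ μ) (hH : IsHyperbolicMeasure ν (force S c) φ μ)
    (hF : Real.sqrt (∫ y, ‖force S c y‖ ^ 2) ≤ F) (hFpos : 0 < F) (hE : 0 < E) (hε : 0 < ε)
    (hEn : ensembleEnergy μ ≤ E) (hD : ε ≤ ensembleDissipation ν μ) :
    LoudAt S ν (16 * F ^ 2 * E ^ 2 / ε ^ 2 + ε / 4) (ε / 4) c := by
  haveI := hμ.prob
  -- Stub 2: the closing property from hyperbolicity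
  have hcl : HasKatokClosing K φ μ := stub_closingLemma hν hK hμ hH
  -- Stub 3: Birkhoff budgets with the pointwise power budget
  obtain ⟨En, D, hEm, hDm, hE0, hEi, hDi, hIE, hID, hpow, hlim⟩ := stub_birkhoffPowerBudget hν hK hμ
  -- budget selection (proved): the loud cell has positive measure
  set B : Set Hsp := {x | En x ≤ 16 * F ^ 2 * E ^ 2 / ε ^ 2 ∧ ε / 2 ≤ D x} with hBdef
  have hBm : MeasurableSet B := (hEm measurableSet_Iic).inter (hDm measurableSet_Ici)
  have hpow' : ∀ x, D x ≤ F * Real.sqrt (En x) := fun x =>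
    (hpow x).trans (mul_le_mul_of_nonneg_right hF (Real.sqrt_nonneg _))
  have hsel := budget_selection μ hDm hEm hE0 hFpos hE hε hpow' hDi hEi (by rw [hID]; exact hD)
    (by rw [hIE]; exact hEn)
  have hμB : μ B ≠ 0 := by
    have hpos : 0 < ENNReal.ofReal (ε ^ 2 / (16 * F ^ 2 * E)) := ENNReal.ofReal_pos.2 (by positivity)
    exact (lt_of_lt_of_le hpos hsel).ne'
  have hbud : ∀ x ∈ B, En x ≤ 16 * F ^ 2 * E ^ 2 / ε ^ 2 ∧ ε / 2 ≤ D x := fun x hx => hx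
  -- Stub 4: close a typical recurrence of a loud trajectory, budgets within ε/4
  obtain ⟨z, hz, T, hT, hfix, hEz, hDz⟩ :=
    stub_closingWithBudgets hK hμ hcl hBm hμB hbud hlim (by positivity : (0:ℝ) < ε / 4)
  -- Stub 5: the periodic point is a classical periodic witness of the same force
  obtain ⟨u, p, hsol, hper, hmE, hmD⟩ := stub_classicalPeriodicWitness hν hK hz hT hfix
  refine ⟨T, u, p, hT, hsol, hper, ?_, ?_⟩
  · rw [hmE]; exact hEz
  · rw [hmD]; linarith

/-- Density survives intersection with an open set: `U' ∩ closure A ⊆ closure (U' ∩ A)`. [folklore] -/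
theorem subset_closure_inter_of_isOpen {X : Type*} [TopologicalSpace X] {U' A : Set X} (hU' : IsOpen U') :
    U' ∩ closure A ⊆ closure (U' ∩ A) :=
  hU'.inter_closure

/-- **Composition: the five stubs prove the crux `DenseLoudDesignerForces` (by name).**
Given `S₀`, Stub 1 gives `S ⊇ S₀`, `E`, `ε > 0` and a window `U` for the loud-hyperbolic-measure sets `HYP_j`.
Shrink to `U' := U ∩ B(c₀, 1)` (still open, non-empty, and `HYP_j` still dense in it), on which
`‖f_c‖₂ ≤ F := √(#S)(‖c₀‖+1) + 1` (`sqrt_forceEnergy_le`); put `E₊ := max E 1`.  The crux's witnesses are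
`(S, E* := 16F²E₊²/ε² + ε/4, ε* := ε/4, U')`: for every `j`, `HYP_j ∩ U' ⊆ LOUD_j(S,E*,ε*)` by
`loudAt_of_hypLoud`, and `U' ⊆ closure (HYP_j ∩ U') ⊆ closure LOUD_j`. -/
theorem DenseLoudDesignerForces_of : DenseLoudDesignerForces := by
  intro S₀
  obtain ⟨S, hS, E, ε, hε, U, hUo, ⟨c₀, hc₀⟩, hdense⟩ := stub_denseHyperbolicLoudMeasures S₀
  -- shrink the window to the ball `U ∩ B(c₀,1)`: the force size, hence the budget inflation, becomes uniform
  have hU'o : IsOpen (U ∩ Metric.ball c₀ 1) := hUo.inter Metric.isOpen_ball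
  have hEpos : 0 < max E 1 := lt_of_lt_of_le one_pos (le_max_right _ _)
  have hFpos : 0 < Real.sqrt (S.card * (‖c₀‖ + 1) ^ 2) + 1 := by positivity
  refine ⟨S, hS,
    16 * (Real.sqrt (S.card * (‖c₀‖ + 1) ^ 2) + 1) ^ 2 * (max E 1) ^ 2 / ε ^ 2 + ε / 4, ε / 4,
    by positivity, U ∩ Metric.ball c₀ 1, hU'o, ⟨c₀, hc₀, Metric.mem_ball_self one_pos⟩, fun j => ?_⟩
  -- density: U' ⊆ closure (U' ∩ HYP_j) ⊆ closure LOUD_j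
  rintro c ⟨hcU, hcball⟩
  have h1 : c ∈ closure ((U ∩ Metric.ball c₀ 1) ∩ hypLoudSet S E ε j) :=
    subset_closure_inter_of_isOpen hU'o ⟨⟨hcU, hcball⟩, hdense j hcU⟩
  refine closure_mono ?_ h1
  rintro c' ⟨⟨-, hc'ball⟩, ν, hν, hνj, K, φ, μ, hK, hμ, hEn, hD, hH⟩
  -- the force of `c'` is bounded by `F` on the ball
  have hF : Real.sqrt (∫ y, ‖force S c' y‖ ^ 2) ≤ Real.sqrt (S.card * (‖c₀‖ + 1) ^ 2) + 1 := by
    have hdist : dist c' c₀ < 1 := by rwa [Metric.mem_ball] at hc'ball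
    have := sqrt_forceEnergy_le hdist
    linarith
  -- the chain at the force `c'`, energy budget relaxed to `max E 1 > 0`
  exact ⟨ν, hν, hνj, loudAt_of_hypLoud hν hK hμ hH hF hFpos hEpos hε (hEn.trans (le_max_left _ _)) hD⟩

end Summit.AnomalousDissipation.AnomalousDissipation.Cruxes.DenseLoudDesignerForces.ErgodicBudgetSelectionClosing

end
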